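import Literature.AlgebraicGeometry.Motives.AbelianVarietyLevelAdjointTranslates
import Literature.AlgebraicGeometry.Motives.AbelianVarietyPicZeroOfAmple
import Literature.AlgebraicGeometry.Motives.Jacobian
import HarnessLib

/-!
# The pull-back `f^* D_y(Θ)` of a translation class along a homomorphism is again a translation class
# (Mumford, *Abelian Varieties*, §8: `Pic⁰` is functorial and, over `ℂ`, exhausted by `t_x^*L ⊗ L⁻¹` for `L` ample — §8 Thm. 1)

Layer `Literature/AlgebraicGeometry/Motives`, namespaces `Literature.AlgebraicGeometry.Motives.AbelianVariety` / `….Jacobian`.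
KERNEL ONLY: theorems; no definition, no named fact, no instance, no `sorry`.

For a homomorphism `f : A → B` of abelian varieties over a field `K` (dominant, so that the honest pull-back of Cartier
divisors `CartierDivisor.pullback` is available), a Cartier divisor `Θ` on `B` and a point `y ∈ B(K)`, write
`D_y(Θ) := t_y^*Θ − Θ` (★ `AbelianVariety.weilDiv Θ y`).  Mumford §8 (iv) (p. 75): «`Pic⁰` is a contravariant functor»;
in divisor currency this is the TRANSLATION INVARIANCE of `f^* D_y(Θ)`:

* `pullback_translation_pullback_weilDiv_sameDivisor` — `t_z^* f^* D_y(Θ)` is the same divisor as `f^* t_{f z}^* D_y(Θ)`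
  (`t_z ≫ f = f ≫ t_{f z}`, ★ `translation_left_comp_toSchemeHom`; any field);
* **`pullback_translation_pullback_weilDiv_linEquiv`** — `t_z^* f^* D_y(Θ) ∼ f^* D_y(Θ)` for every `z ∈ A(K)` (theorem of the
  square on `B`: ★ `pullback_translation_weilDiv_linEquiv`, and pull-backs respect `∼`; any field);
* **`exists_pullback_weilDiv_linEquiv_weilDiv`** — over `ℂ`, for `Θ_A` AMPLE on `A`: `f^* D_y(Θ) ∼ D_x(Θ_A)` for SOME `x ∈ A(ℂ)`
  (Mumford §8 Thm. 1 over `ℂ`, ★ `exists_linEquiv_weilDiv_of_forall_translate_linEquiv`: a translation-invariant class is a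
  `D_x(Θ_A)`; i.e. `f^*` maps `Pic⁰(B)` into `φ_{Θ_A}(A(ℂ)) = Pic⁰(A)`);
* **`Jacobian.exists_pullback_weilDiv_linEquiv_weilDiv`** — the instance for the norm map `Nm_p : J_X → J_Y` of a morphism of
  curves (★ `Jacobian.pushforward`): `Nm_p^* D^{Θ_Y}_y ∼ D^{Θ_X}_x` for some `x ∈ J_X(ℂ)` — the LETTER §1 (g4-2) of the cell's
  road G4 (`A-provers/A-p04/g17/G4.sockets.A-p04g17.lean`), VERBATIM.

Cell `hodgecm-mathlib` (D-0151), road G4 toward the named fact (F-P2) `Jacobian.galoisCover_pullback_isWeilPairingAdjoint_norm`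
([Lange2023AbelianVarietiesComplex] §4.5.2 eq. (4.9) «`N̂_f φ_{Θ′} = φ_Θ f^*`» read as `D^{Θ_X}_{t y} ∼ Nm^* D^{Θ_Y}_y`; this file
supplies «`Nm^* D_y` is SOME `D_x`», the assembly identifies `x = t y`).  Count-neutral capital of rows VI-7/VI-8; HC_CM is proved
only modulo the 7 printed citations until rung 0 closes — this file moves no book.

## References
* [MumfordAV1970] D. Mumford, *Abelian Varieties* (1970), §8 (pp. 74–77): properties (i)–(iv) of `Pic⁰` (p. 75: «`Pic⁰` is a
  contravariant functor», «`t_x^*L ≅ L` for `L ∈ Pic⁰`») and Theorem 1 (p. 77); §6 Cor. 4 (p. 59, theorem of the square);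
  §4 (Cor. 1 of the rigidity lemma: homomorphisms intertwine translations).
* [Lange2023AbelianVarietiesComplex] H. Lange, *Abelian Varieties over the Complex Numbers* (2023), §2.2 (`Pic⁰`, `φ_L` onto
  `X̂` for `L` ample) and §4.5.2 eq. (4.9).
-/

noncomputable section

universe u

open CategoryTheory CategoryTheory.Limits AlgebraicGeometry

namespace Literature.AlgebraicGeometry.Motives

namespace AbelianVariety

variable {K : Type u} [Field K] {A B : AbelianVariety K} (f : A ⟶ B) [IsDominant (Hom.toSchemeHom f)]

/-- **`t_z^* f^* D_y(Θ) = f^* t_{f z}^* D_y(Θ)` as divisors**: translations are intertwined by the homomorphism `f`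
(`t_z ≫ f = f ≫ t_{f z}`, Mumford §4), so both sides have the same local equations on the same opens.
[cite: MumfordAV1970, §4 (Cor. 1 of the rigidity lemma) and §8 (iv) (p. 75)] -/
theorem pullback_translation_pullback_weilDiv_sameDivisor (Θ : CartierDivisor B.X.left) (y : B.Points K) (z : A.Points K) :
    (((B.weilDiv Θ y).pullback (Hom.toSchemeHom f)).pullback (A.translation z).left).SameDivisor
      (((B.weilDiv Θ y).pullback (B.translation (AlgPoints.map f.hom.hom.hom z)).left).pullback (Hom.toSchemeHom f)) := by
  have ht := translation_left_comp_toSchemeHom f z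
  haveI : IsDominant ((A.translation z).left ≫ Hom.toSchemeHom f) := inferInstance
  haveI : IsDominant (Hom.toSchemeHom f ≫ (B.translation (AlgPoints.map f.hom.hom.hom z)).left) := inferInstance
  exact (((B.weilDiv Θ y).pullback_pullback_sameDivisor _ _).trans ((B.weilDiv Θ y).pullback_congr_sameDivisor ht)).trans
    ((B.weilDiv Θ y).pullback_pullback_sameDivisor _ _).symm

/-- **`f^* D_y(Θ)` is translation invariant: `t_z^* f^* D_y(Θ) ∼ f^* D_y(Θ)`** for every `z ∈ A(K)` — `t_z^* f^* D_y = f^* t_{fz}^* D_y`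
and `t_{fz}^* D_y ∼ D_y` by the theorem of the square on `B` (★ `pullback_translation_weilDiv_linEquiv`), pulled back along `f`.
This is Mumford §8 (iv) «`Pic⁰` is a contravariant functor» with §8 (ii)' «`L ∈ Pic⁰ ⇒ t_x^*L ≅ L`», in divisor currency.
[cite: MumfordAV1970, §8 (ii), (iv) (p. 75) and §6 Cor. 4 (p. 59)] -/
theorem pullback_translation_pullback_weilDiv_linEquiv (Θ : CartierDivisor B.X.left) (y : B.Points K) (z : A.Points K) :
    (((B.weilDiv Θ y).pullback (Hom.toSchemeHom f)).pullback (A.translation z).left).LinEquiv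
      ((B.weilDiv Θ y).pullback (Hom.toSchemeHom f)) :=
  (pullback_translation_pullback_weilDiv_sameDivisor f Θ y z).linEquiv.trans
    ((B.pullback_translation_weilDiv_linEquiv Θ y (AlgPoints.map f.hom.hom.hom z)).pullback (Hom.toSchemeHom f))

/-- **`f^* D_y(Θ) ∼ D_x(Θ_A)` for some `x ∈ A(ℂ)`** (complex abelian varieties, `Θ_A` ample on `A`, `Θ` ANY Cartier divisor on `B`):
the class `f^* D_y(Θ)` is translation invariant (`pullback_translation_pullback_weilDiv_linEquiv`), hence of the form `D_x(Θ_A)` by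
Mumford §8 Theorem 1 over `ℂ` (★ `exists_linEquiv_weilDiv_of_forall_translate_linEquiv`: `x ↦ [t_x^*Θ_A − Θ_A]` is onto `Pic⁰(A)`).
[cite: MumfordAV1970, §8 Theorem 1 (p. 77) and §8 (iv) (p. 75)] [cite: Lange2023AbelianVarietiesComplex, §2.2] -/
theorem exists_pullback_weilDiv_linEquiv_weilDiv {A B : AbelianVariety ℂ} (f : A ⟶ B) [IsDominant (Hom.toSchemeHom f)]
    {ΘA : CartierDivisor A.X.left} (hΘA : ΘA.IsAmple) (Θ : CartierDivisor B.X.left) (y : B.Points ℂ) :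
    ∃ x : A.Points ℂ, ((B.weilDiv Θ y).pullback (Hom.toSchemeHom f)).LinEquiv (A.weilDiv ΘA x) :=
  A.exists_linEquiv_weilDiv_of_forall_translate_linEquiv hΘA _ (pullback_translation_pullback_weilDiv_linEquiv f Θ y)

end AbelianVariety

namespace Jacobian

variable {X Y : SchemeOver ℂ} (𝒥X : Jacobian X) (𝒥Y : Jacobian Y) (p : X ⟶ Y)
  [IsDominant (AbelianVariety.Hom.toSchemeHom (𝒥X.pushforward 𝒥Y p))]

/-- **Road G4, letter §1 (g4-2): `Nm_p^* D^{Θ_Y}_y ∼ D^{Θ_X}_x` for SOME `x ∈ J_X(ℂ)`** — for Jacobians `𝒥X`, `𝒥Y` of complex curves,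
a morphism `p : X → Y` with dominant norm map `Nm_p = 𝒥X.pushforward 𝒥Y p : J_X → J_Y`, `Θ_X` ample on `J_X`, `Θ_Y` any Cartier divisor
on `J_Y` and `y ∈ J_Y(ℂ)` (`AbelianVariety.exists_pullback_weilDiv_linEquiv_weilDiv` for `f = Nm_p`).  [Lange2023] (4.9)
«`N̂_f φ_{Θ′} = φ_Θ f^*`»: the left-hand side lands in `φ_{Θ}(J)`; the road's assembly then identifies `x`.
[cite: MumfordAV1970, §8 Theorem 1 (p. 77) and §8 (iv) (p. 75)] [cite: Lange2023AbelianVarietiesComplex, §4.5.2 eq. (4.9)] -/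
theorem exists_pullback_weilDiv_linEquiv_weilDiv {ΘX : CartierDivisor 𝒥X.J.X.left} (hΘX : ΘX.IsAmple)
    (ΘY : CartierDivisor 𝒥Y.J.X.left) (y : 𝒥Y.J.Points ℂ) :
    ∃ x : 𝒥X.J.Points ℂ,
      ((𝒥Y.J.weilDiv ΘY y).pullback (AbelianVariety.Hom.toSchemeHom (𝒥X.pushforward 𝒥Y p))).LinEquiv (𝒥X.J.weilDiv ΘX x) :=
  AbelianVariety.exists_pullback_weilDiv_linEquiv_weilDiv (𝒥X.pushforward 𝒥Y p) hΘX ΘY y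

end Jacobian

end Literature.AlgebraicGeometry.Motives

end
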